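import Mathlib
import HarnessLib
import Summits.HubbardSuperconductivity.HubbardSuperconductivity.Theorems.KLProgrammeKLRegimeTwoVolumeTowerTruncProfileBridge
import Summits.HubbardSuperconductivity.HubbardSuperconductivity.Theorems.KLProgrammeKLRegimeTwoVolumeTowerTruncProfileReadout
import Summits.HubbardSuperconductivity.HubbardSuperconductivity.Theorems.KLProgrammeKLRegimeTwoVolumeTowerSrcScaledKit

/-!
# Route `KLProgramme` — crux K3, VL child `KLRegimeVolumeLimitV17F2` (stmt-HubbardSuperconductivity-20440), blueprint v5 M5-TS: THE PROFILE FIELD OF THE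
# SOURCE-RESCALED TRUNCATED BUNDLE FROM THE PRODUCERS' CURRENCY — the budgets `S₀ + t·S₁ + t²·S₂` (located «SRC-DEG2», cure (β) of plan g22 (R171);
# seat hubbard-kl-k3c4-p1 g15; `--supports` 20440)

Twin of `…TowerTruncProfileBridge` / `…TowerTruncProfileReadout` (p619661 / p620581) for the RESCALED read-out: `…TowerSrcScaledDefs.TowerVolumeDataTS.profile`
asks, at step `j`, for `WtProfileEven (srcTrunc 3 (klTowerDS V M β U μ K t j)) (Λ j) (ε·NV j)`, `klTowerDS … t j = S_t (klTowerD … j)`.  A string with `s`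
source legs carries `t^s` (`…TowerSrcScaledDefs.kernel_srcScale`), so the producers' currency `klSrcPinnedSumAt … j r (j+1) s m q w ≤ S s m` (`s ≤ 2`:
E1's alive read-out `s = 0`, token #24 `s ∈ {1,2}`) gives the budget **`ε · (S 0 (2m) + t·S 1 (2m) + t²·S 2 (2m))`** — THIS is where cure (β) bites: the
source families' free degree-`≤ 2` budgets `A (j+1) s` enter (H3) with the factors `t`, `t²`, `t ∈ (0,1]` at the assembler's disposal ([BGM06] §2.9 (4.6)–(4.8)).

* **`wtProfileEven_srcTrunc_klTowerDS_of_srcPinnedSumAt`** — the dictionary with the `t`-weights;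
* **`wtProfileEven_srcTrunc_klTowerDS_of_readout`** — from E1's alive read-out (`klWtPinnedSumAt`, budget `S₀`) ⊕ `SourceProfilesAtLev S … j r (j+1)`:
  budget `ε · (S₀ (2m) + t·S 1 (2m) + t²·S 2 (2m))`.

Proofs only; no definition. [cite: BenfattoGiulianiMastropietro2006, §2.7 (2.70)–(2.71), §2.9 (4.3)–(4.8)]
-/

noncomputable section

namespace Summit.HubbardSuperconductivity.HubbardSuperconductivity.Theorems.TwoVolumeSource

set_option linter.dupNamespace false -- summit = problem name (single-conjunct summit), D-0017

open Finset Filter Topology Literature.MathematicalPhysics.QuantumLattice GrassmannAlgebra Literature.Probability.LatticeModels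
  Literature.Probability.LatticeModels.BattleFederbush
open Summit.HubbardSuperconductivity.HubbardSuperconductivity.Theorems.TwoPointAssembly
open Summit.HubbardSuperconductivity.HubbardSuperconductivity.Theorems.KLRegimeSplit
open Summit.HubbardSuperconductivity.HubbardSuperconductivity.Theorems.KLProgrammeLegKernels
open Summit.HubbardSuperconductivity.HubbardSuperconductivity.Theorems.EngineV8
open Summit.HubbardSuperconductivity.HubbardSuperconductivity.Theorems.TwoVolumeDefect

variable {V M : ℕ} [NeZero V] [NeZero M]

/-- **`TowerVolumeDataTS.profile` FROM THE PRODUCERS' CURRENCY** (see the module docstring): bounds `S s m` on `klSrcPinnedSumAt … j r (j+1) s m q w` for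
`s ≤ 2` give the weighted even profile of `srcTrunc 3 (klTowerDS … t j)`, `0 ≤ t`, at any rate `Λ ≤ Λ_r` with budget `ε · (S 0 (2m) + t·S 1 (2m) + t²·S 2 (2m))`.
[cite: BenfattoGiulianiMastropietro2006, §2.9 (4.3)-(4.8)] -/
theorem wtProfileEven_srcTrunc_klTowerDS_of_srcPinnedSumAt {β : ℝ} (hβ : 0 < β) (U μ : ℝ) (K : TrigPolyC4v) {t : ℝ} (ht : 0 ≤ t) (j r : ℕ) {Λ : ℝ}
    (hΛr : Λ ≤ klScale klE0 r) (S : ℕ → ℕ → ℝ) (hS0 : ∀ s m, 0 ≤ S s m)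
    (h : ∀ s, s ≤ 2 → ∀ (m : ℕ) (q : Fin m) (w : SrcLabel V M j), klSrcPinnedSumAt V M β U μ K j r (j + 1) s m q w ≤ S s m) :
    WtProfileEven (srcTrunc ℂ (fun q : SrcLabel V M j => q.2 = 1) 3 (klTowerDS V M β U μ K t j)) Λ
      (fun m => imagTimeWeight β M * (S 0 (2 * m) + t * S 1 (2 * m) + t ^ 2 * S 2 (2 * m))) := by
  classical
  have hε : 0 < imagTimeWeight β M := by
    have hM : (0 : ℝ) < M := Nat.cast_pos.2 (Nat.pos_of_ne_zero (NeZero.ne M))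
    unfold imagTimeWeight; positivity
  refine ⟨fun m => mul_nonneg hε.le (add_nonneg (add_nonneg (hS0 0 _) (mul_nonneg ht (hS0 1 _))) (mul_nonneg (sq_nonneg t) (hS0 2 _))),
    fun m' jx x => ?_⟩
  -- degree `0` has no pin
  rcases m' with _ | m₁
  · exact jx.elim0
  -- abbreviations
  set D := klTowerD V M β U μ K j with hD
  set wt : (Fin (2 * (m₁ + 1)) → SrcLabel V M j) → ℝ := fun Y =>
    1 + labelDiam (fun Y₁ Y₂ : SrcLabel V M j => Λ * (Torus.tnorm (Y₁.1.1.2 - Y₂.1.1.2) : ℝ)) (univ.image Y) with hwt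
  set g : ℕ → (Fin (2 * (m₁ + 1)) → SrcLabel V M j) → ℝ := fun s Y =>
    if srcCount (fun q : SrcLabel V M j => q.2 = 1) Y = s then
      klScaleWt V M β r ((univ.image Y).image (srcLegPos V M (2 * (2 * M)))) * ‖kernel ℂ D (2 * (m₁ + 1)) Y‖ else 0 with hg
  have hwt0 : ∀ Y, 0 ≤ wt Y := fun Y => add_nonneg zero_le_one (labelDiam_nonneg _ _)
  have hwtle : ∀ Y, wt Y ≤ klScaleWt V M β r ((univ.image Y).image (srcLegPos V M (2 * (2 * M)))) :=
    fun Y => one_add_labelDiam_mul_tnorm_le_klScaleWt_src hβ.le hΛr Y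
  have hg0 : ∀ s Y, 0 ≤ g s Y := fun s Y => by
    simp only [hg]; split_ifs
    · exact mul_nonneg (zero_le_one.trans (one_le_klScaleWt _ _ _ _ _)) (norm_nonneg _)
    · exact le_rfl
  -- termwise: the rescaled truncated term is below `g 0 + t·g 1 + t²·g 2` (a string with `s` source legs carries `t^s`)
  have hterm : ∀ Y : Fin (2 * (m₁ + 1)) → SrcLabel V M j,
      ‖kernel ℂ (srcTrunc ℂ (fun q : SrcLabel V M j => q.2 = 1) 3 (klTowerDS V M β U μ K t j)) (2 * (m₁ + 1)) Y‖ * wt Y ≤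
        g 0 Y + t * g 1 Y + t ^ 2 * g 2 Y := by
    intro Y
    have h0 := hg0 0 Y; have h1 := hg0 1 Y; have h2 := hg0 2 Y
    have hgs : ∀ s, srcCount (fun q : SrcLabel V M j => q.2 = 1) Y = s →
        g s Y = klScaleWt V M β r ((univ.image Y).image (srcLegPos V M (2 * (2 * M)))) * ‖kernel ℂ D (2 * (m₁ + 1)) Y‖ :=
      fun s hs => by simp only [hg, hs, if_true]
    have hsc : ‖kernel ℂ (klTowerDS V M β U μ K t j) (2 * (m₁ + 1)) Y‖ =
        t ^ srcCount (fun q : SrcLabel V M j => q.2 = 1) Y * ‖kernel ℂ D (2 * (m₁ + 1)) Y‖ := by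
      rw [klTowerDS_eq, kernel_srcScale, norm_mul, norm_pow, RCLike.norm_ofReal, abs_of_nonneg ht]
    rw [kernel_srcTrunc]
    by_cases hlt : srcCount (fun q : SrcLabel V M j => q.2 = 1) Y < 3
    · rw [if_pos hlt, hsc]
      have hb : ‖kernel ℂ D (2 * (m₁ + 1)) Y‖ * wt Y ≤ klScaleWt V M β r ((univ.image Y).image (srcLegPos V M (2 * (2 * M)))) * ‖kernel ℂ D (2 * (m₁ + 1)) Y‖ := by
        rw [mul_comm]; exact mul_le_mul_of_nonneg_right (hwtle Y) (norm_nonneg _)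
      obtain hs | hs | hs : srcCount (fun q : SrcLabel V M j => q.2 = 1) Y = 0 ∨ srcCount (fun q : SrcLabel V M j => q.2 = 1) Y = 1 ∨
          srcCount (fun q : SrcLabel V M j => q.2 = 1) Y = 2 := by omega
      · rw [hs, pow_zero, one_mul, hgs 0 hs]
        linarith [mul_nonneg ht h1, mul_nonneg (sq_nonneg t) h2]
      · rw [hs, pow_one, hgs 1 hs]
        linarith [mul_le_mul_of_nonneg_left hb ht, mul_nonneg (sq_nonneg t) h2]
      · rw [hs, hgs 2 hs]
        linarith [mul_le_mul_of_nonneg_left hb (sq_nonneg t), mul_nonneg ht h1]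
    · rw [if_neg hlt, norm_zero, zero_mul]
      exact add_nonneg (add_nonneg h0 (mul_nonneg ht h1)) (mul_nonneg (sq_nonneg t) h2)
  -- the `g s` sums are `ε · klSrcPinnedSumAt … s`
  have hsum : ∀ s, ∑ Y ∈ univ.filter (fun Y : Fin (2 * (m₁ + 1)) → SrcLabel V M j => Y jx = x), g s Y =
      imagTimeWeight β M * klSrcPinnedSumAt V M β U μ K j r (j + 1) s (2 * (m₁ + 1)) jx x := by
    intro s
    simp only [hg]
    rw [← sum_filter, filter_filter]
    exact sum_srcCount_filter_eq_eps_mul_klSrcPinnedSumAt hβ.le U μ K j r s (2 * (m₁ + 1)) (by omega) jx x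
  -- assemble
  calc ∑ Y ∈ univ.filter (fun Y : Fin (2 * (m₁ + 1)) → SrcLabel V M j => Y jx = x),
        ‖kernel ℂ (srcTrunc ℂ (fun q : SrcLabel V M j => q.2 = 1) 3 (klTowerDS V M β U μ K t j)) (2 * (m₁ + 1)) Y‖ * wt Y
      ≤ ∑ Y ∈ univ.filter (fun Y : Fin (2 * (m₁ + 1)) → SrcLabel V M j => Y jx = x), (g 0 Y + t * g 1 Y + t ^ 2 * g 2 Y) :=
        sum_le_sum fun Y _ => hterm Y
    _ = imagTimeWeight β M * (klSrcPinnedSumAt V M β U μ K j r (j + 1) 0 (2 * (m₁ + 1)) jx x +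
          t * klSrcPinnedSumAt V M β U μ K j r (j + 1) 1 (2 * (m₁ + 1)) jx x + t ^ 2 * klSrcPinnedSumAt V M β U μ K j r (j + 1) 2 (2 * (m₁ + 1)) jx x) := by
        rw [sum_add_distrib, sum_add_distrib, ← mul_sum, ← mul_sum, hsum 0, hsum 1, hsum 2]; ring
    _ ≤ imagTimeWeight β M * (S 0 (2 * (m₁ + 1)) + t * S 1 (2 * (m₁ + 1)) + t ^ 2 * S 2 (2 * (m₁ + 1))) :=
        mul_le_mul_of_nonneg_left (add_le_add (add_le_add (h 0 (by norm_num) _ jx x)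
          (mul_le_mul_of_nonneg_left (h 1 (by norm_num) _ jx x) ht)) (mul_le_mul_of_nonneg_left (h 2 le_rfl _ jx x) (sq_nonneg t))) hε.le

/-- **`TowerVolumeDataTS.profile` FROM E1's READ-OUT ⊕ TOKEN #24** (see the module docstring): budget `ε · (S₀ (2m) + t·S 1 (2m) + t²·S 2 (2m))`.
[cite: BenfattoGiulianiMastropietro2006, §2.9 (4.3)-(4.8)] -/
theorem wtProfileEven_srcTrunc_klTowerDS_of_readout {β : ℝ} (hβ : 0 < β) (U μ : ℝ) (K : TrigPolyC4v) {t : ℝ} (ht : 0 ≤ t) (j r : ℕ) {Λ : ℝ}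
    (hΛr : Λ ≤ klScale klE0 r) (S₀ : ℕ → ℝ) (S : ℕ → ℕ → ℝ) (hS₀ : ∀ m, 0 ≤ S₀ m) (hS : ∀ s m, 0 ≤ S s m)
    (h0 : ∀ (m : ℕ) (q : Fin m) (w : SpaceTimeIdx V M × SectorLeg (sectorCount j)),
      klWtPinnedSumAt V M β μ K j r m (klEffectiveAction V M β U μ K klE0 (j + 1)) q w ≤ S₀ m)
    (h12 : SourceProfilesAtLev V M S β U μ K j r (j + 1)) :
    WtProfileEven (srcTrunc ℂ (fun q : SrcLabel V M j => q.2 = 1) 3 (klTowerDS V M β U μ K t j)) Λ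
      (fun m => imagTimeWeight β M * (S₀ (2 * m) + t * S 1 (2 * m) + t ^ 2 * S 2 (2 * m))) := by
  have h := wtProfileEven_srcTrunc_klTowerDS_of_srcPinnedSumAt hβ U μ K ht j r hΛr (fun s m => if s = 0 then S₀ m else S s m)
    (fun s m => by
      show 0 ≤ (if s = 0 then S₀ m else S s m)
      split_ifs; exacts [hS₀ m, hS s m])
    (fun s hs m q w => by
      show klSrcPinnedSumAt V M β U μ K j r (j + 1) s m q w ≤ (if s = 0 then S₀ m else S s m)
      split_ifs with h0'
      · subst h0'; exact (klSrcPinnedSumAt_zero_le_klWtPinnedSumAt hβ.le U μ K j r (j + 1) m q w).trans (h0 m q w.1)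
      · exact h12 s (by omega) hs m q w)
  simpa using h

end Summit.HubbardSuperconductivity.HubbardSuperconductivity.Theorems.TwoVolumeSource

end
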